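import Summits.ValiantsHypothesis.ValiantsHypothesis.Theorems.DefinabilityGapAlterationStep
import Summits.ValiantsHypothesis.ValiantsHypothesis.Theorems.DefinabilityGapPhaseABad
import HarnessLib

/-!
# Definability gap, ROAD P: the COST of a merge to clauses 2–3 (N1 v2 §(5e), deterministic)

After a re-pick round the assignment is `mergeRows Mv r r'` (`DefinabilityGapAlterationStep`).
Its Phase-A statistics are controlled by those of `r` plus the MOVERS' contribution under `r'`,
and the movers' contribution is a FULL kill sum for the sub-family `T ∩ Mv` — so the Bernstein /
union-bound machinery of Phase A applies to it verbatim (g8).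

* `sum_mergeRows_le` — for nonnegative `f`: `Σ_{c'} f c' (merge c') ≤ Σ_{c'} f c' (r c') +
  Σ_{c' ∈ Mv} f c' (r' c')`;
* `sum_movers_rowKillOn_eq` / `…colKillOn_eq` / `…rowKill_eq` / `…colKill_eq` — the movers'
  part equals the kill sum of the family `T ∩ Mv`;
* `card_freeCols_merge_ge` / `card_freeRows_merge_ge` — free positions drop by at most the
  movers' (unrestricted) kill sum;
* **`mergeRows_not_mem_phaseABad`** — the read-off: if `r ∉ phaseABad T M N n₀ p t B` and the
  movers' kill sums under `r'` are `< t₂` on every light-restricted line and `≤ δ` on every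
  line, then `mergeRows Mv r r' ∉ phaseABad T M N n₀ p (t + t₂) (B − δ)`.
-/

namespace Summit.ValiantsHypothesis.ValiantsHypothesis.Theorems.DefinabilityGapMergeCost

open Finset
open Literature.Computability.AlgebraicComplexity Literature.Computability.MetaComplexity
open Summit.ValiantsHypothesis.ValiantsHypothesis.Theorems.DefinabilityGapAffineRung
open Summit.ValiantsHypothesis.ValiantsHypothesis.Theorems.DefinabilityGapPivotCertificate
open Summit.ValiantsHypothesis.ValiantsHypothesis.Theorems.DefinabilityGapPivotAdmissible
open Summit.ValiantsHypothesis.ValiantsHypothesis.Theorems.DefinabilityGapPivotRandom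
open Summit.ValiantsHypothesis.ValiantsHypothesis.Theorems.DefinabilityGapPivotGoodLines
open Summit.ValiantsHypothesis.ValiantsHypothesis.Theorems.DefinabilityGapPivotCrowded
open Summit.ValiantsHypothesis.ValiantsHypothesis.Theorems.DefinabilityGapCrowdedFree
open Summit.ValiantsHypothesis.ValiantsHypothesis.Theorems.DefinabilityGapAlterationStep
open Summit.ValiantsHypothesis.ValiantsHypothesis.Theorems.DefinabilityGapPhaseABad

variable {m : ℕ}

/-! ## 1. Splitting a sum over the merge -/

open scoped Classical in
/-- For nonnegative `f`, the merged sum is at most the old sum plus the movers' new terms.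
[this file] -/
theorem sum_mergeRows_le (Mv : Finset (Fin 3 → Fin (qOf m)))
    (r r' : (Fin 3 → Fin (qOf m)) → Fin m) (f : (Fin 3 → Fin (qOf m)) → Fin m → ℝ)
    (hf : ∀ c a, 0 ≤ f c a) :
    ∑ c', f c' (mergeRows Mv r r' c') ≤ (∑ c', f c' (r c')) + ∑ c' ∈ Mv, f c' (r' c') := by
  have hsplit : ∑ c', f c' (mergeRows Mv r r' c') =
      (∑ c' ∈ Mv, f c' (r' c')) +
        ∑ c' ∈ (Finset.univ : Finset (Fin 3 → Fin (qOf m))).filter (fun c' => c' ∉ Mv),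
          f c' (r c') := by
    rw [← Finset.sum_filter_add_sum_filter_not Finset.univ (fun c' => c' ∈ Mv)]
    congr 1
    · rw [Finset.filter_mem_eq_inter, Finset.univ_inter]
      exact Finset.sum_congr rfl fun c' hc' => by rw [mergeRows_of_mem hc']
    · exact Finset.sum_congr rfl fun c' hc' => by
        rw [mergeRows_of_not_mem (Finset.mem_filter.mp hc').2]
  rw [hsplit, add_comm]
  refine add_le_add ?_ le_rfl
  exact Finset.sum_le_sum_of_subset_of_nonneg (Finset.filter_subset _ _) fun c' _ _ => hf c' _

/-! ## 2. The movers' part is the kill sum of the sub-family `T ∩ Mv` -/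

open scoped Classical in
/-- Movers' restricted row kills = kill sum of `T ∩ Mv`. [this file] -/
theorem sum_movers_rowKillOn_eq (S : Finset (Fin m)) (T Mv : Finset (Fin 3 → Fin (qOf m)))
    (c : Fin 3 → Fin (qOf m)) (i : Fin m) (a : (Fin 3 → Fin (qOf m)) → Fin m) :
    ∑ c' ∈ Mv, rowKillOn S T c i c' (a c') = ∑ c', rowKillOn S (T ∩ Mv) c i c' (a c') := by
  rw [← Finset.sum_filter_add_sum_filter_not Finset.univ (fun c' => c' ∈ Mv)
    (fun c' => rowKillOn S (T ∩ Mv) c i c' (a c')), Finset.filter_mem_eq_inter, Finset.univ_inter]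
  have h0 : ∑ c' ∈ Finset.univ.filter (fun c' => c' ∉ Mv), rowKillOn S (T ∩ Mv) c i c' (a c')
      = 0 := Finset.sum_eq_zero fun c' hc' => by
    unfold rowKillOn
    rw [if_neg]
    exact fun h => (Finset.mem_filter.mp hc').2 (Finset.mem_inter.mp h.1).2
  rw [h0, add_zero]
  refine Finset.sum_congr rfl fun c' hc' => ?_
  unfold rowKillOn
  simp only [Finset.mem_inter, hc', and_true]

open scoped Classical in
/-- Movers' restricted column kills = kill sum of `T ∩ Mv`. [this file] -/
theorem sum_movers_colKillOn_eq (R : Finset (Fin m)) (T Mv : Finset (Fin 3 → Fin (qOf m)))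
    (c : Fin 3 → Fin (qOf m)) (j : Fin m) (a : (Fin 3 → Fin (qOf m)) → Fin m) :
    ∑ c' ∈ Mv, colKillOn R T c j c' (a c') = ∑ c', colKillOn R (T ∩ Mv) c j c' (a c') := by
  rw [← Finset.sum_filter_add_sum_filter_not Finset.univ (fun c' => c' ∈ Mv)
    (fun c' => colKillOn R (T ∩ Mv) c j c' (a c')), Finset.filter_mem_eq_inter, Finset.univ_inter]
  have h0 : ∑ c' ∈ Finset.univ.filter (fun c' => c' ∉ Mv), colKillOn R (T ∩ Mv) c j c' (a c')
      = 0 := Finset.sum_eq_zero fun c' hc' => by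
    unfold colKillOn
    rw [if_neg]
    exact fun h => (Finset.mem_filter.mp hc').2 (Finset.mem_inter.mp h.1).2
  rw [h0, add_zero]
  refine Finset.sum_congr rfl fun c' hc' => ?_
  unfold colKillOn
  simp only [Finset.mem_inter, hc', and_true]

/-! ## 3. Free positions after the merge -/

open scoped Classical in
/-- A free column of row `i` of `c` under `r` stays free under the merge unless a MOVER
co-curve through that cell got the new row `i`. [this file] -/
theorem freeCols_merge_supset (T Mv : Finset (Fin 3 → Fin (qOf m))) (c : Fin 3 → Fin (qOf m))
    (r r' : (Fin 3 → Fin (qOf m)) → Fin m) (i : Fin m) :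
    (freeCols T c r i).filter (fun j => ∀ c' ∈ coCurves T c (i, j), c' ∈ Mv → r' c' ≠ i) ⊆
      freeCols T c (mergeRows Mv r r') i := by
  intro j hj
  obtain ⟨hfree, hmov⟩ := Finset.mem_filter.mp hj
  rw [mem_freeCols] at hfree ⊢
  intro c' hc'
  by_cases h : c' ∈ Mv
  · rw [mergeRows_of_mem h]; exact hmov c' hc' h
  · rw [mergeRows_of_not_mem h]; exact hfree c' hc'

open scoped Classical in
/-- The columns of row `i` of `c` hit by movers landing in row `i` number at most the movers'
row-`i` kill sum (family `T ∩ Mv`). [this file] -/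
theorem card_hitCols_le (T Mv : Finset (Fin 3 → Fin (qOf m))) (c : Fin 3 → Fin (qOf m))
    (r' : (Fin 3 → Fin (qOf m)) → Fin m) (i : Fin m) :
    (((Finset.univ : Finset (Fin m)).filter fun j =>
        ∃ c' ∈ coCurves T c (i, j), c' ∈ Mv ∧ r' c' = i).card : ℝ) ≤
      ∑ c', rowKill (T ∩ Mv) c i c' (r' c') := by
  set K := (Finset.univ : Finset (Fin 3 → Fin (qOf m))).filter
    fun c' => c' ∈ T ∩ Mv ∧ c' ≠ c ∧ r' c' = i with hK
  have hsub : ((Finset.univ : Finset (Fin m)).filter fun j =>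
      ∃ c' ∈ coCurves T c (i, j), c' ∈ Mv ∧ r' c' = i) ⊆
      K.biUnion fun c' => Finset.univ.filter fun j => cellEmb m c' (i, j) = cellEmb m c (i, j) := by
    intro j hj
    obtain ⟨c', hc', hM, hr⟩ := (Finset.mem_filter.mp hj).2
    obtain ⟨hT, hne, heq⟩ := mem_coCurves.mp hc'
    exact Finset.mem_biUnion.mpr ⟨c', Finset.mem_filter.mpr
      ⟨Finset.mem_univ _, Finset.mem_inter.mpr ⟨hT, hM⟩, hne, hr⟩,
      Finset.mem_filter.mpr ⟨Finset.mem_univ _, heq⟩⟩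
  have h1 := (Finset.card_le_card hsub).trans Finset.card_biUnion_le
  have h2 : ((∑ c' ∈ K, ((Finset.univ : Finset (Fin m)).filter fun j =>
      cellEmb m c' (i, j) = cellEmb m c (i, j)).card : ℕ) : ℝ) =
      ∑ c', rowKill (T ∩ Mv) c i c' (r' c') := by
    rw [hK, Finset.sum_filter]
    push_cast
    refine Finset.sum_congr rfl fun c' _ => ?_
    unfold rowKill rowOverlap
    split_ifs <;> rfl
  calc _ ≤ ((∑ c' ∈ K, ((Finset.univ : Finset (Fin m)).filter fun j =>
        cellEmb m c' (i, j) = cellEmb m c (i, j)).card : ℕ) : ℝ) := by exact_mod_cast h1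
    _ = _ := h2

open scoped Classical in
/-- **Free columns after the merge**: `#freeCols(merge) ≥ #freeCols(r) − (movers' row-i kill
sum)`. [this file] -/
theorem card_freeCols_merge_ge (T Mv : Finset (Fin 3 → Fin (qOf m)))
    (c : Fin 3 → Fin (qOf m)) (r r' : (Fin 3 → Fin (qOf m)) → Fin m) (i : Fin m) :
    ((freeCols T c r i).card : ℝ) - ∑ c', rowKill (T ∩ Mv) c i c' (r' c') ≤
      ((freeCols T c (mergeRows Mv r r') i).card : ℝ) := by
  have hsup := Finset.card_le_card (freeCols_merge_supset T Mv c r r' i)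
  have hhit := card_hitCols_le T Mv c r' i
  -- the filtered-out free columns are hit columns
  have hsplit := Finset.card_filter_add_card_filter_not (s := freeCols T c r i)
    (fun j => ∀ c' ∈ coCurves T c (i, j), c' ∈ Mv → r' c' ≠ i)
  have hout : ((freeCols T c r i).filter fun j =>
      ¬ ∀ c' ∈ coCurves T c (i, j), c' ∈ Mv → r' c' ≠ i).card ≤
      ((Finset.univ : Finset (Fin m)).filter fun j =>
        ∃ c' ∈ coCurves T c (i, j), c' ∈ Mv ∧ r' c' = i).card := by
    refine Finset.card_le_card fun j hj => ?_
    have h := (Finset.mem_filter.mp hj).2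
    push Not at h
    exact Finset.mem_filter.mpr ⟨Finset.mem_univ _, h⟩
  have e1 : ((freeCols T c r i).card : ℝ) =
      (((freeCols T c r i).filter fun j =>
          ∀ c' ∈ coCurves T c (i, j), c' ∈ Mv → r' c' ≠ i).card : ℝ) +
        (((freeCols T c r i).filter fun j =>
          ¬ ∀ c' ∈ coCurves T c (i, j), c' ∈ Mv → r' c' ≠ i).card : ℝ) := by
    exact_mod_cast hsplit.symm
  have e2 : (((freeCols T c r i).filter fun j =>
      ∀ c' ∈ coCurves T c (i, j), c' ∈ Mv → r' c' ≠ i).card : ℝ) ≤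
      ((freeCols T c (mergeRows Mv r r') i).card : ℝ) := by exact_mod_cast hsup
  have e3 : (((freeCols T c r i).filter fun j =>
      ¬ ∀ c' ∈ coCurves T c (i, j), c' ∈ Mv → r' c' ≠ i).card : ℝ) ≤
      ∑ c', rowKill (T ∩ Mv) c i c' (r' c') := le_trans (by exact_mod_cast hout) hhit
  linarith

open scoped Classical in
/-- A free row of column `j` stays free unless a mover co-curve through that cell got that row.
[this file] -/
theorem freeRows_merge_supset (T Mv : Finset (Fin 3 → Fin (qOf m))) (c : Fin 3 → Fin (qOf m))
    (r r' : (Fin 3 → Fin (qOf m)) → Fin m) (j : Fin m) :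
    (freeRows T c r j).filter (fun a => ∀ c' ∈ coCurves T c (a, j), c' ∈ Mv → r' c' ≠ a) ⊆
      freeRows T c (mergeRows Mv r r') j := by
  intro a ha
  obtain ⟨hfree, hmov⟩ := Finset.mem_filter.mp ha
  rw [mem_freeRows] at hfree ⊢
  intro c' hc'
  by_cases h : c' ∈ Mv
  · rw [mergeRows_of_mem h]; exact hmov c' hc' h
  · rw [mergeRows_of_not_mem h]; exact hfree c' hc'

open scoped Classical in
/-- The rows of column `j` of `c` hit by movers number at most the movers' column-`j` kill sum
(family `T ∩ Mv`). [this file] -/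
theorem card_hitRows_le (T Mv : Finset (Fin 3 → Fin (qOf m))) (c : Fin 3 → Fin (qOf m))
    (r' : (Fin 3 → Fin (qOf m)) → Fin m) (j : Fin m) :
    (((Finset.univ : Finset (Fin m)).filter fun a =>
        ∃ c' ∈ coCurves T c (a, j), c' ∈ Mv ∧ r' c' = a).card : ℝ) ≤
      ∑ c', colKill (T ∩ Mv) c j c' (r' c') := by
  set K := (Finset.univ : Finset (Fin 3 → Fin (qOf m))).filter
    fun c' => c' ∈ T ∩ Mv ∧ c' ≠ c ∧ cellEmb m c' (r' c', j) = cellEmb m c (r' c', j) with hK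
  have hcard : ((Finset.univ : Finset (Fin m)).filter fun a =>
      ∃ c' ∈ coCurves T c (a, j), c' ∈ Mv ∧ r' c' = a).card ≤ K.card := by
    calc _ ≤ (K.image r').card := Finset.card_le_card fun a ha => by
            obtain ⟨c', hc', hM, hr⟩ := (Finset.mem_filter.mp ha).2
            obtain ⟨hT, hne, heq⟩ := mem_coCurves.mp hc'
            refine Finset.mem_image.mpr ⟨c', Finset.mem_filter.mpr
              ⟨Finset.mem_univ _, Finset.mem_inter.mpr ⟨hT, hM⟩, hne, ?_⟩, hr⟩
            rw [hr]; exact heq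
      _ ≤ K.card := Finset.card_image_le
  have h2 : (K.card : ℝ) = ∑ c', colKill (T ∩ Mv) c j c' (r' c') := by
    rw [hK, Finset.card_filter, Nat.cast_sum]
    refine Finset.sum_congr rfl fun c' _ => ?_
    unfold colKill
    split_ifs <;> simp
  calc _ ≤ (K.card : ℝ) := by exact_mod_cast hcard
    _ = _ := h2

open scoped Classical in
/-- **Free rows after the merge**: `#freeRows(merge) ≥ #freeRows(r) − (movers' column-j kill
sum)`. [this file] -/
theorem card_freeRows_merge_ge (T Mv : Finset (Fin 3 → Fin (qOf m)))
    (c : Fin 3 → Fin (qOf m)) (r r' : (Fin 3 → Fin (qOf m)) → Fin m) (j : Fin m) :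
    ((freeRows T c r j).card : ℝ) - ∑ c', colKill (T ∩ Mv) c j c' (r' c') ≤
      ((freeRows T c (mergeRows Mv r r') j).card : ℝ) := by
  have hsup := Finset.card_le_card (freeRows_merge_supset T Mv c r r' j)
  have hhit := card_hitRows_le T Mv c r' j
  have hsplit := Finset.card_filter_add_card_filter_not (s := freeRows T c r j)
    (fun a => ∀ c' ∈ coCurves T c (a, j), c' ∈ Mv → r' c' ≠ a)
  have hout : ((freeRows T c r j).filter fun a =>
      ¬ ∀ c' ∈ coCurves T c (a, j), c' ∈ Mv → r' c' ≠ a).card ≤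
      ((Finset.univ : Finset (Fin m)).filter fun a =>
        ∃ c' ∈ coCurves T c (a, j), c' ∈ Mv ∧ r' c' = a).card := by
    refine Finset.card_le_card fun a ha => ?_
    have h := (Finset.mem_filter.mp ha).2
    push Not at h
    exact Finset.mem_filter.mpr ⟨Finset.mem_univ _, h⟩
  have e1 : ((freeRows T c r j).card : ℝ) =
      (((freeRows T c r j).filter fun a =>
          ∀ c' ∈ coCurves T c (a, j), c' ∈ Mv → r' c' ≠ a).card : ℝ) +
        (((freeRows T c r j).filter fun a =>
          ¬ ∀ c' ∈ coCurves T c (a, j), c' ∈ Mv → r' c' ≠ a).card : ℝ) := by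
    exact_mod_cast hsplit.symm
  have e2 : (((freeRows T c r j).filter fun a =>
      ∀ c' ∈ coCurves T c (a, j), c' ∈ Mv → r' c' ≠ a).card : ℝ) ≤
      ((freeRows T c (mergeRows Mv r r') j).card : ℝ) := by exact_mod_cast hsup
  have e3 : (((freeRows T c r j).filter fun a =>
      ¬ ∀ c' ∈ coCurves T c (a, j), c' ∈ Mv → r' c' ≠ a).card : ℝ) ≤
      ∑ c', colKill (T ∩ Mv) c j c' (r' c') := le_trans (by exact_mod_cast hout) hhit
  linarith

/-! ## 4. The read-off -/

open scoped Classical in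
/-- **COST OF A MERGE.**  If `r` is off the Phase-A bad set with thresholds `(t, B)` and the
movers' kill sums under `r'` (family `T ∩ Mv`) are `< t₂` on every light-restricted line and
`≤ δ` on every line of every block of `T`, then `mergeRows Mv r r'` is off the Phase-A bad set
with thresholds `(t + t₂, B − δ)`. [this file] -/
theorem mergeRows_not_mem_phaseABad (T Mv : Finset (Fin 3 → Fin (qOf m))) {M N n₀ : ℕ}
    {p t B t₂ δ : ℝ} {r r' : (Fin 3 → Fin (qOf m)) → Fin m}
    (hr : r ∉ phaseABad T M N n₀ p t B)
    (hrow : ∀ c ∈ T, ∀ i : Fin m,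
      ∑ c', rowKillOn (lightCols T c M i) (T ∩ Mv) c i c' (r' c') < t₂)
    (hcol : ∀ c ∈ T, ∀ j : Fin m,
      ∑ c', colKillOn (lightRows T c M j) (T ∩ Mv) c j c' (r' c') < t₂)
    (hfrow : ∀ c ∈ T, ∀ i : Fin m, ∑ c', rowKill (T ∩ Mv) c i c' (r' c') ≤ δ)
    (hfcol : ∀ c ∈ T, ∀ j : Fin m, ∑ c', colKill (T ∩ Mv) c j c' (r' c') ≤ δ) :
    mergeRows Mv r r' ∉ phaseABad T M N n₀ p (t + t₂) (B - δ) := by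
  unfold phaseABad at hr ⊢
  simp only [Finset.mem_union, Finset.mem_filter, Finset.mem_univ, true_and, not_or] at hr ⊢
  obtain ⟨⟨⟨hR, hC⟩, hF⟩, hG⟩ := hr
  refine ⟨⟨⟨?_, ?_⟩, ?_⟩, ?_⟩
  · rintro ⟨c, hc, i, hi⟩
    have hold : ∑ c', rowKillOn (lightCols T c M i) T c i c' (r c') < p * ((m : ℝ) * M) + t := by
      by_contra hge; exact hR ⟨c, hc, i, not_lt.mp hge⟩
    have hle := sum_mergeRows_le Mv r r' (fun c' a => rowKillOn (lightCols T c M i) T c i c' a)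
      (fun c' a => rowKillOn_nonneg _ T c i c' a)
    beta_reduce at hle
    rw [sum_movers_rowKillOn_eq (lightCols T c M i) T Mv c i r'] at hle
    have := hrow c hc i
    linarith
  · rintro ⟨c, hc, j, hj⟩
    have hold : ∑ c', colKillOn (lightRows T c M j) T c j c' (r c') < p * ((m : ℝ) * M) + t := by
      by_contra hge; exact hC ⟨c, hc, j, not_lt.mp hge⟩
    have hle := sum_mergeRows_le Mv r r' (fun c' a => colKillOn (lightRows T c M j) T c j c' a)
      (fun c' a => colKillOn_nonneg _ T c j c' a)
    beta_reduce at hle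
    rw [sum_movers_colKillOn_eq (lightRows T c M j) T Mv c j r'] at hle
    have := hcol c hc j
    linarith
  · rintro ⟨c, hc, i, hi, hlt⟩
    have hold : B ≤ ((freeCols T c r i).card : ℝ) := by
      by_contra hlt'; exact hF ⟨c, hc, i, hi, not_le.mp hlt'⟩
    have := card_freeCols_merge_ge T Mv c r r' i
    have := hfrow c hc i
    linarith
  · rintro ⟨c, hc, j, hj, hlt⟩
    have hold : B ≤ ((freeRows T c r j).card : ℝ) := by
      by_contra hlt'; exact hG ⟨c, hc, j, hj, not_le.mp hlt'⟩
    have := card_freeRows_merge_ge T Mv c r r' j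
    have := hfcol c hc j
    linarith

end Summit.ValiantsHypothesis.ValiantsHypothesis.Theorems.DefinabilityGapMergeCost
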